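import Summits.BirchSwinnertonDyer.BirchSwinnertonDyer.Theorems.SignedLowerHalvesSmallImageLowerHalfBothSignsRttD2SeqJ3CoeffPairing
import Summits.BirchSwinnertonDyer.BirchSwinnertonDyer.Theorems.SignedLowerHalvesSmallImageLowerHalfBothSignsRttD2SeqJ3Levelwise
import HarnessLib

/-!
# Route `SignedLowerHalves`, crux L `SmallImageLowerHalfBothSigns` (stmt-BirchSwinnertonDyer-23599), line `rtt_w3` v14 → v15 — E2, row J3 (Galois side):
# J3 FOR THE LEAD's MODULE `M = Cofree θ F = (F/𝒪)(θ)` — `j₀ : B′ →ₗ[Λ_𝒪] DQ.X` with `Function.Exact j₀ gX` on the strict carrier — MODULO EXACTLY THE TWO LEVELWISE POITOU–TATE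
# STATEMENTS (reciprocity `R`, solvability `hsolL`), the character relation `θ′θ = 1` and the consumer's pin `hres`

WIDTH seat `bsd-line-slh-p3-w3` g22 under LEAD `cruxlead-stmt-BirchSwinnertonDyer-23599` g11 (cell `bsd-ssimc`); helper `--supports stmt-BirchSwinnertonDyer-23599`. ONE THEOREM.
HONEST FRAMING: `exists_junction_exact_of_levelwise` (p790532) with the coefficient pairings instantiated by `cofreeCoeffPairing` (p791753) — so ALL inputs this seat could discharge
structurally are discharged; what remains (`R`, `hsolL`) is finite-level Poitou–Tate mathematics (junction-1 / successor). E2, crux L, crux M and BSD remain OPEN, proved for NO curve.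

★★★ `exists_junction_exact_cofree`. References: [Kobayashi2003] Thm. 7.3 i); [Rubin2000] Thm. 1.7.3, §4.2; [NeukirchSchmidtWingberg2008] VIII §6, (7.2.6); [Kato2004Asterisque] §17.13.
-/

set_option autoImplicit false
set_option linter.dupNamespace false -- D-0017: single-problem summit, the namespace repeats the problem name by design
noncomputable section

open scoped Classical
open NumberField IsDedekindDomain Field Matrix

namespace Summit.BirchSwinnertonDyer.BirchSwinnertonDyer.Theorems.SmallImageRttD2Seq

open Literature.NumberTheory.EllipticCurves Literature.NumberTheory.EllipticCurves.Kobayashi2003 Literature.NumberTheory.EllipticCurves.GreenbergSelmer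
  Literature.NumberTheory.EllipticCurves.GreenbergVatsal2000 Literature.NumberTheory.GaloisRepresentations Literature.NumberTheory.GaloisCohomology
  Literature.NumberTheory.ComplexMultiplication.EllipticUnits.JohnsonLeungKings2011
  Summit.BirchSwinnertonDyer.BirchSwinnertonDyer.Theorems.SmallImageCharSignedSelmer
  Summit.BirchSwinnertonDyer.BirchSwinnertonDyer.Theorems.SmallImageRttD2J1

section CofreeJ3

variable {K : Type} [Field K] [NumberField K] {p : ℕ} [Fact p.Prime] {κ : ZpExtension K p} {γ : absoluteGaloisGroup K}
  (S : Set (PadicAlgCl p)) [FiniteDimensional ℚ_[p] (padicCoeffField S)]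
  (θ : FramedGaloisRep K (padicCoeffIntegers S) 1)
  {V : WeierstrassCurve K} {j : V.geomPrimaryTorsion p →+ Cofree θ (padicCoeffField S)} {S₀ : Set (HeightOneSpectrum (𝓞 K))} {ε : ℤˣ}
  (D : SignedTransportDualDataSat κ γ (Cofree θ (padicCoeffField S)) (padicCoeffIntegers S) V j S₀ ε)
  {v : HeightOneSpectrum (𝓞 K)} [DistribMulAction (absoluteGaloisGroup (v.adicCompletion K)) (Cofree θ (padicCoeffField S))]
  [SMulCommClass (absoluteGaloisGroup (v.adicCompletion K)) (padicCoeffIntegers S) (Cofree θ (padicCoeffField S))]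
  {γv : absoluteGaloisGroup (v.adicCompletion K)} (DQ : LocalCondDualData κ (Cofree θ (padicCoeffField S)) (padicCoeffIntegers S) V j ε v γv)
  (hres : ∀ (σ : absoluteGaloisGroup (v.adicCompletion K)) (m : Cofree θ (padicCoeffField S)), σ • m = resGalOfEmb (closureEmb (K := K) (v.adicCompletion K)) σ • m)
  (hvp : (p : 𝓞 K) ∈ v.asIdeal)
  {γB : absoluteGaloisGroup K} {θ' : absoluteGaloisGroup K →ₜ* (padicCoeffIntegers S)ˣ} {P : Set (HeightOneSpectrum (𝓞 K))}
  (I : CycIwasawaCohomologyDataO S κ γB θ' P 1)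
  (hstab : ∀ m : Cofree θ (padicCoeffField S),
    IsOpen (MulAction.stabilizer (absoluteGaloisGroup (v.adicCompletion K)) m : Set (absoluteGaloisGroup (v.adicCompletion K))))
  (hθ : ∀ σ : absoluteGaloisGroup K,
    ((θ' σ : (padicCoeffIntegers S)ˣ) : padicCoeffIntegers S) * ((θ σ : GL (Fin 1) (padicCoeffIntegers S)) : Matrix (Fin 1) (Fin 1) (padicCoeffIntegers S)) 0 0 = 1)
  (htor : ∀ m : Cofree θ (padicCoeffField S), ∃ k : ℕ, p ^ k • m = 0)
  (hγB : γB * resGalOfEmb (closureEmb (K := K) (v.adicCompletion K)) γv ∈ κ.kerSubgroup)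
  (hNP : ∀ n, ramificationSubgroup K P ≤ κ.layerSubgroup n) (hv : AcSigned.IsNonsplitIn κ v)

/-- ★★★ **J3 FOR `M = (F/𝒪)(θ)`, MODULO THE TWO LEVELWISE POITOU–TATE STATEMENTS.** With `Pk := cofreeCoeffPairing …` (the trace pairings `⟪a ⊗ ζ, t/p^k⟫ = Tr(a t)·ζ`, `θ′θ = 1`),
`𝓛 := layerPairingOf …`, `Str := strictLevel …`, `Good := goodLevel …`: given the levelwise reciprocity `R` and solvability `hsolL`, there is a `Λ_𝒪`-linear `j₀` on the strict carrier with
`DQ.toDual ∘ j₀ = P|_{B′}` and `Function.Exact j₀ gX`. [cite: Kobayashi2003, Thm. 7.3 i)] [cite: Rubin2000, Thm. 1.7.3, §4.2] [cite: NeukirchSchmidtWingberg2008, VIII §6] [cite: Kato2004Asterisque, §17.13] -/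
theorem exists_junction_exact_cofree (instX : Module (IwasawaAlgebraO S) D.X) (instQ : Module (IwasawaAlgebraO S) DQ.X)
    (hιX : ∀ (f : IwasawaAlgebra p) (x : D.X), (letI := instX; iwasawaToIwasawaO S f • x) = f • x)
    (hιQ : ∀ (f : IwasawaAlgebra p) (x : DQ.X), (letI := instQ; iwasawaToIwasawaO S f • x) = f • x)
    (hCX : ∀ (a : padicCoeffIntegers S) (x : D.X) (s : signedTransportSelmerInftySat κ (Cofree θ (padicCoeffField S)) (padicCoeffIntegers S) V j S₀ ε),
      D.toDual (letI := instX; (PowerSeries.C a : IwasawaAlgebraO S) • x) s =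
        D.toDual x ⟨GreenbergSelmer.scalarH1 κ.kerSubgroup (Cofree θ (padicCoeffField S)) a s,
          scalarH1_mem_signedTransportSelmerInftySat κ (Cofree θ (padicCoeffField S)) (padicCoeffIntegers S) V j S₀ ε a s.2⟩)
    (hCQ : ∀ (a : padicCoeffIntegers S) (x : DQ.X) (c : localCondInftySat κ (Cofree θ (padicCoeffField S)) (padicCoeffIntegers S) V j ε v),
      DQ.toDual (letI := instQ; (PowerSeries.C a : IwasawaAlgebraO S) • x) c = DQ.toDual x (scalarLocalSat κ (Cofree θ (padicCoeffField S)) (padicCoeffIntegers S) V j ε v a c))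
    (hstabK : ∀ m : Cofree θ (padicCoeffField S), IsOpen (MulAction.stabilizer (absoluteGaloisGroup K) m : Set (absoluteGaloisGroup K)))
    (hγ : κ.IsTopGenerator γ) (hγv : κ.IsTopGenerator (resGalOfEmb (closureEmb (K := K) (v.adicCompletion K)) γv)) (hP : P.Finite)
    (R : ∀ (n k : ℕ) (y : cycLayerCohO S κ θ' P n k 1), y ∈ strictLevel S κ θ' P S₀ n k →
      ∀ (ℓ : subgroupH1 (localSubgroupOfEmb (κ.layerSubgroup n) (closureEmb (K := K) (v.adicCompletion K))) ↥(torsionPow (Cofree θ (padicCoeffField S)) p k))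
        (c : subgroupH1 (κ.layerSubgroup n) (Cofree θ (padicCoeffField S))),
        c ∈ signedTransportSelmerLayerSat κ (Cofree θ (padicCoeffField S)) (padicCoeffIntegers S) V j S₀ ε n →
        torsToH1 (Cofree θ (padicCoeffField S)) p _ k ℓ = locH1Layer κ (Cofree θ (padicCoeffField S)) v hres n c →
        locPairNK S κ θ' P v (Cofree θ (padicCoeffField S)) hstab (cofreeCoeffPairing S θ' P v θ hres hstab hθ) n k y ℓ = 0)
    (hsolL : ∀ q : localCondInftySat κ (Cofree θ (padicCoeffField S)) (padicCoeffIntegers S) V j ε v →+ AddCircle (1 : ℚ),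
      (∀ s : signedTransportSelmerInftySat κ (Cofree θ (padicCoeffField S)) (padicCoeffIntegers S) V j S₀ ε,
        q (locSat κ (Cofree θ (padicCoeffField S)) (padicCoeffIntegers S) V j S₀ ε v hres hvp s) = 0) →
      ∀ m : ℕ, ∃ y ∈ strictLevel S κ θ' P S₀ m m,
        ∀ (ℓ : subgroupH1 (localSubgroupOfEmb (κ.layerSubgroup m) (closureEmb (K := K) (v.adicCompletion K))) ↥(torsionPow (Cofree θ (padicCoeffField S)) p m))
          (hℓ : ℓ ∈ goodLevel S κ v (Cofree θ (padicCoeffField S)) V j ε m m),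
          locPairNK S κ θ' P v (Cofree θ (padicCoeffField S)) hstab (cofreeCoeffPairing S θ' P v θ hres hstab hθ) m m y ℓ = q ⟨_, hℓ⟩) :
    letI := instX; letI := instQ
    ∃ j₀ : strictCarrier I (strictLevel S κ θ' P S₀) (fun n k f _ hy ↦ smul_mem_strictLevel S κ θ' P S₀ γB n k f hy) →ₗ[IwasawaAlgebraO S] DQ.X,
      (∀ b, DQ.toDual (j₀ b) = strictPairing (layerPairingOf S κ θ' P v (Cofree θ (padicCoeffField S)) hstab (cofreeCoeffPairing S θ' P v θ hres hstab hθ) htor γB γv hγB hNP hv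
        (cofreeCoeffPairing_hPred S θ' P v θ hres hstab hθ) (cofreeCoeffPairing_hPsc S θ' P v θ hres hstab hθ)) I (strictLevel S κ θ' P S₀)
        (fun n k f _ hy ↦ smul_mem_strictLevel S κ θ' P S₀ γB n k f hy) hstab b) ∧
      Function.Exact j₀ (gXLinearMapO S D DQ hres hvp instX instQ hιX hιQ hCX hCQ htor hstabK hstab hγ hv hγv) :=
  exists_junction_exact_of_levelwise S D DQ hres hvp I hstab (cofreeCoeffPairing S θ' P v θ hres hstab hθ) htor hγB hNP hv
    (cofreeCoeffPairing_hPred S θ' P v θ hres hstab hθ) (cofreeCoeffPairing_hPsc S θ' P v θ hres hstab hθ) instX instQ hιX hιQ hCX hCQ hstabK hγ hγv hP R hsolL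

end CofreeJ3

end Summit.BirchSwinnertonDyer.BirchSwinnertonDyer.Theorems.SmallImageRttD2Seq

end
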